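import Summits.CriticalPhenomena.CardyFormulaZ2.Theorems.CardyIKTransportIKLinearTransportTwoSidedKernel

/-!
# Stub `stub_TwoSidedCutMarkovKernel` (K₂) — part 2: THE LAW of the two-sided kernel (fibrewise over the atoms)

Support file (`--supports stmt-CriticalPhenomena-5076`, lead c2; registered sub-goal `tc_kernel_law_of`).

THE `law` FIELD of `CutMarkovKernel S i (tcK i T)` from the factorisation identity `TcFactorisation i T`: for a measurable
set `A` of statistic values, split `A` by `tcBoth`. Off `tcBoth` the kernel is `cmkK` and `cmk_kernel_law` applies. On
`tcBoth` the configurations are partitioned into the ATOMS `tcEv (rowStat x)`; the partition is indexed by the countable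
CODE `tcCode` (the two cut rows, the finitely many window bits, the finitely many past bits), the kernel is constant on each
atom, and on each atom the factorisation identity is exactly the required equality; sum over the code.
-/

noncomputable section

namespace Summit.CriticalPhenomena.CardyFormulaZ2.Theorems.IKLinearTransport.PinnedDiagramExchange

open scoped Classical MeasureTheory ENNReal symmDiff
open Set MeasureTheory
open Literature.Probability.Percolation Literature.Probability.LatticeModels

/-! ## §1 The code of an atom -/

/-- The (countable) code space: cut rows, window cells, window faces, window boundary pairs, past cells, past faces. [folklore] -/
abbrev TcCodeSp : Type :=
  ℤ × ℤ × Finset (ℤ × ℤ) × Finset (ℤ × ℤ) × Finset ((ℤ × ℤ) × (ℤ × ℤ)) × Finset (ℤ × ℤ) × Finset (ℤ × ℤ)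

/-- Measurable structure on the code space: discrete (Mathlib has none on `Finset`). [folklore] -/
instance TcCodeSp.instMeasurableSpace : MeasurableSpace TcCodeSp := ⊤

/-- Every set of codes is measurable. [folklore] -/
instance TcCodeSp.instMeasurableSingletonClass : MeasurableSingletonClass TcCodeSp := ⟨fun _ => trivial⟩

/-- Explicit cell from integer coordinates. [folklore] -/
def tcMk (ab : ℤ × ℤ) : Site 2 := ![ab.1, ab.2]

/-- Window cell coordinates: columns `i … i+2`, rows `[c-2, c'+2]`. [folklore] -/
def tcWc (i c c' : ℤ) : Finset (ℤ × ℤ) := Finset.Icc i (i + 2) ×ˢ Finset.Icc (c - 2) (c' + 2)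

/-- Window boundary-pair coordinates: columns `i, i+2`, rows `[c-2, c'+2]`, twice. [folklore] -/
def tcWp (i c c' : ℤ) : Finset ((ℤ × ℤ) × (ℤ × ℤ)) :=
  (({i, i + 2} : Finset ℤ) ×ˢ Finset.Icc (c - 2) (c' + 2)) ×ˢ (({i, i + 2} : Finset ℤ) ×ˢ Finset.Icc (c - 2) (c' + 2))

/-- Past middle-cell coordinates: column `i+1`, rows `[c+1, -1]`. [folklore] -/
def tcZc (i c : ℤ) : Finset (ℤ × ℤ) := ({i + 1} : Finset ℤ) ×ˢ Finset.Icc (c + 1) (-1)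

/-- Past strip-face coordinates: columns `i, i+1`, rows `[c+1, -1]`. [folklore] -/
def tcZf (i c : ℤ) : Finset (ℤ × ℤ) := ({i, i + 1} : Finset ℤ) ×ˢ Finset.Icc (c + 1) (-1)

/-- THE CODE of a configuration with both cuts (junk `0`-code otherwise). [folklore] -/
def tcCode (i : ℤ) (x : Obs) : TcCodeSp :=
  if tcBoth i (pinnedStat i x) then
    (cmkCstar i (pinnedStat i x), cmkCfirst i (pinnedStat i x),
      (tcWc i (cmkCstar i (pinnedStat i x)) (cmkCfirst i (pinnedStat i x))).filter (fun ab => tcMk ab ∈ (pinnedStat i x).1.1),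
      (tcWc i (cmkCstar i (pinnedStat i x)) (cmkCfirst i (pinnedStat i x))).filter (fun ab => tcMk ab ∈ (pinnedStat i x).1.2),
      (tcWp i (cmkCstar i (pinnedStat i x)) (cmkCfirst i (pinnedStat i x))).filter
        (fun q => ((tcMk q.1, tcMk q.2) : Site 2 × Site 2) ∈ (pinnedStat i x).2),
      (tcZc i (cmkCstar i (pinnedStat i x))).filter (fun ab => tcMk ab ∈ x.1),
      (tcZf i (cmkCstar i (pinnedStat i x))).filter (fun ab => tcMk ab ∈ x.2))
  else (0, 0, ∅, ∅, ∅, ∅, ∅)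

/-- A configuration with both cuts lies in its own atom. [folklore] -/
theorem mem_tcEv_self (i : ℤ) (x : Obs) : x ∈ tcEv i (rowStat i x) := by
  refine ⟨⟨rfl, rfl, ⟨fun w _ _ _ _ => ⟨Iff.rfl, Iff.rfl⟩, fun q _ _ _ _ => Iff.rfl⟩⟩, fun w _ hw2 => ⟨fun hw0 => ?_, fun hw0 => ?_⟩⟩
  · simp only [rowStat, pastMid, mem_setOf_eq]
    exact ⟨fun h => ⟨h, hw0, by omega⟩, fun h => h.1⟩
  · simp only [rowStat, pastMid, mem_setOf_eq]
    exact ⟨fun h => ⟨h, hw0, by omega⟩, fun h => h.1⟩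

/-- Pairs of the strip diagram are boundary-column pairs. [folklore] -/
theorem tc_stripDiagram_bd (i : ℤ) (x : Obs) {q : Site 2 × Site 2} (hq : q ∈ stripDiagram i x) :
    (q.1 0 = i ∨ q.1 0 = i + 2) ∧ (q.2 0 = i ∨ q.2 0 = i + 2) := ⟨hq.1, hq.2.1⟩

/-- Reading a `Finset.filter` equality pointwise. [folklore] -/
theorem tc_filter_eq_iff {α : Type*} (s : Finset α) (p q : α → Prop) [DecidablePred p] [DecidablePred q] :
    s.filter p = s.filter q ↔ ∀ a ∈ s, (p a ↔ q a) := by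
  constructor
  · intro h a ha
    have := congrArg (fun t : Finset α => a ∈ t) h
    simp only [Finset.mem_filter, ha, true_and, eq_iff_iff] at this
    exact this
  · intro h; exact Finset.filter_congr h

/-- THE FIBRE LEMMA: on `tcBoth`, the atom of the row statistic of `x` is the fibre of the code through `x`. [folklore] -/
theorem tcEv_eq_fibre (i : ℤ) (x : Obs) (hb : tcBoth i (pinnedStat i x)) :
    tcEv i (rowStat i x) = {x' | tcCode i x' = tcCode i x} := by
  have hx : tcCode i x = _ := if_pos hb
  ext x'
  simp only [mem_setOf_eq]
  constructor
  · rintro ⟨⟨e1, e2, hag⟩, hz⟩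
    simp only [rowStat] at e1 e2 hag hz
    have hb' : tcBoth i (pinnedStat i x') := by unfold tcBoth at hb ⊢; rw [e1, e2]; exact hb
    rw [tcCode, if_pos hb', hx, e1, e2]
    obtain ⟨hcell, hpair⟩ := hag
    simp only [Prod.mk.injEq, true_and]
    refine ⟨?_, ?_, ?_, ?_, ?_⟩
    · refine Finset.filter_congr fun ab hab => ?_
      simp only [tcWc, Finset.mem_product, Finset.mem_Icc] at hab
      exact (hcell (tcMk ab) (by simp [tcMk]; omega) (by simp [tcMk]; omega) (by simp [tcMk]; omega) (by simp [tcMk]; omega)).1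
    · refine Finset.filter_congr fun ab hab => ?_
      simp only [tcWc, Finset.mem_product, Finset.mem_Icc] at hab
      exact (hcell (tcMk ab) (by simp [tcMk]; omega) (by simp [tcMk]; omega) (by simp [tcMk]; omega) (by simp [tcMk]; omega)).2
    · refine Finset.filter_congr fun q hq => ?_
      simp only [tcWp, Finset.mem_product, Finset.mem_Icc, Finset.mem_insert, Finset.mem_singleton] at hq
      exact hpair _ (by simp [tcMk]; omega) (by simp [tcMk]; omega) (by simp [tcMk]; omega) (by simp [tcMk]; omega)
    · refine Finset.filter_congr fun ab hab => ?_
      simp only [tcZc, Finset.mem_product, Finset.mem_Icc, Finset.mem_singleton] at hab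
      have := (hz (tcMk ab) (by simp [tcMk]; omega) (by simp [tcMk]; omega)).1 (by simp [tcMk]; omega)
      rw [this]; simp only [pastMid, mem_setOf_eq, tcMk, Matrix.cons_val_zero, Matrix.cons_val_one]
      constructor
      · intro h; exact h.1
      · intro h; exact ⟨h, by omega, by omega⟩
    · refine Finset.filter_congr fun ab hab => ?_
      simp only [tcZf, Finset.mem_product, Finset.mem_Icc, Finset.mem_insert, Finset.mem_singleton] at hab
      have := (hz (tcMk ab) (by simp [tcMk]; omega) (by simp [tcMk]; omega)).2 (by simp [tcMk]; omega)
      rw [this]; simp only [pastMid, mem_setOf_eq, tcMk, Matrix.cons_val_zero, Matrix.cons_val_one]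
      constructor
      · intro h; exact h.1
      · intro h; exact ⟨h, by omega, by omega⟩
  · intro hcode
    have hb' : tcBoth i (pinnedStat i x') := by
      by_contra hnb
      rw [tcCode, if_neg hnb, hx] at hcode
      simp only [Prod.mk.injEq] at hcode
      have := hb.1; omega
    rw [tcCode, if_pos hb', hx] at hcode
    simp only [Prod.mk.injEq] at hcode
    obtain ⟨e1, e2, f1, f2, f3, f4, f5⟩ := hcode
    rw [e1, e2] at f1 f2 f3
    rw [e1] at f4 f5
    rw [tc_filter_eq_iff] at f1 f2 f3 f4 f5
    refine ⟨⟨e1, e2, ⟨fun w hw0 hw0' hw1 hw2 => ?_, fun q hq1 hq2 hq3 hq4 => ?_⟩⟩, fun w hw1 hw2 => ⟨fun hw0 => ?_, fun hw0 => ?_⟩⟩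
    · have hmem : (w 0, w 1) ∈ tcWc i (cmkCstar i (pinnedStat i x)) (cmkCfirst i (pinnedStat i x)) := by
        simp only [tcWc, Finset.mem_product, Finset.mem_Icc]; simp only [rowStat] at hw1 hw2; omega
      have hw : tcMk (w 0, w 1) = w := SDE.site2_eta w
      have a1 := f1 _ hmem; have a2 := f2 _ hmem
      rw [hw] at a1 a2
      exact ⟨a1, a2⟩
    · -- pairs: both diagrams consist of boundary-column pairs
      simp only [rowStat] at hq1 hq2 hq3 hq4 ⊢
      by_cases hbd : (q.1 0 = i ∨ q.1 0 = i + 2) ∧ (q.2 0 = i ∨ q.2 0 = i + 2)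
      · have hmem : ((q.1 0, q.1 1), (q.2 0, q.2 1)) ∈ tcWp i (cmkCstar i (pinnedStat i x)) (cmkCfirst i (pinnedStat i x)) := by
          simp only [tcWp, Finset.mem_product, Finset.mem_Icc, Finset.mem_insert, Finset.mem_singleton]
          refine ⟨⟨?_, hq1, hq2⟩, ?_, hq3, hq4⟩
          · rcases hbd.1 with h | h <;> simp [h]
          · rcases hbd.2 with h | h <;> simp [h]
        have := f3 _ hmem
        have e : ((tcMk (q.1 0, q.1 1), tcMk (q.2 0, q.2 1)) : Site 2 × Site 2) = q :=
          Prod.ext (SDE.site2_eta q.1) (SDE.site2_eta q.2)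
        rw [e] at this
        exact this
      · constructor
        · intro h; exact absurd (tc_stripDiagram_bd i x' h) hbd
        · intro h; exact absurd (tc_stripDiagram_bd i x h) hbd
    · simp only [rowStat] at hw1 hw2 ⊢
      have hmem : (w 0, w 1) ∈ tcZc i (cmkCstar i (pinnedStat i x)) := by
        simp only [tcZc, Finset.mem_product, Finset.mem_Icc, Finset.mem_singleton]; omega
      have hw : tcMk (w 0, w 1) = w := SDE.site2_eta w
      have a := f4 _ hmem
      rw [hw] at a
      rw [a]; simp only [pastMid, mem_setOf_eq]
      exact ⟨fun h => ⟨h, hw0, by omega⟩, fun h => h.1⟩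
    · simp only [rowStat] at hw1 hw2 ⊢
      have hmem : (w 0, w 1) ∈ tcZf i (cmkCstar i (pinnedStat i x)) := by
        simp only [tcZf, Finset.mem_product, Finset.mem_Icc, Finset.mem_insert, Finset.mem_singleton]; omega
      have hw : tcMk (w 0, w 1) = w := SDE.site2_eta w
      have a := f5 _ hmem
      rw [hw] at a
      rw [a]; simp only [pastMid, mem_setOf_eq]
      exact ⟨fun h => ⟨h, hw0, by omega⟩, fun h => h.1⟩

/-- THE CODE IS MEASURABLE (its fibres are atoms or the complement of `tcBoth`). [folklore] -/
theorem measurable_tcCode (i : ℤ) : Measurable (tcCode i) := by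
  refine measurable_to_countable fun x => ?_
  by_cases hb : tcBoth i (pinnedStat i x)
  · have : tcCode i ⁻¹' {tcCode i x} = tcEv i (rowStat i x) := by
      rw [tcEv_eq_fibre i x hb]; rfl
    rw [this]
    exact (measurableSet_tcAtom i _).inter (measurableSet_tcZev i _ _)
  · have : tcCode i ⁻¹' {tcCode i x} = {x' | ¬ tcBoth i (pinnedStat i x')} := by
      ext x'
      simp only [mem_preimage, mem_singleton_iff, mem_setOf_eq]
      have hx : tcCode i x = (0, 0, ∅, ∅, ∅, ∅, ∅) := if_neg hb
      constructor
      · intro h hb'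
        rw [hx, tcCode, if_pos hb'] at h
        simp only [Prod.mk.injEq] at h
        have := hb'.1; omega
      · intro h; rw [hx]; exact if_neg h
    rw [this]
    exact (measurable_pinnedStat i (measurableSet_tcBoth i)).compl

/-! ## §2 The kernel is constant on atoms, and the atom identity -/

/-- On `tcBoth` the kernel at the row statistic is the atom ratio. [folklore] -/
theorem tcK_rowStat_eq (i : ℤ) (T : Set ℤ) (x : Obs) (hb : tcBoth i (pinnedStat i x)) (y : Bool × Bool × Bool) :
    tcK i T (rowStat i x) y =
      (if νmix T (tcEv i (rowStat i x)) = 0 then (if y = (false, false, false) then 1 else 0)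
        else (νmix T (tcEv i (rowStat i x) ∩ {x' | rowBool i x' = y})).toReal / (νmix T (tcEv i (rowStat i x))).toReal) := by
  have : tcBoth i (rowStat i x).1 := hb
  simp only [tcK, this, if_true]

/-- THE ATOM IDENTITY: on an atom `G = tcEv (rowStat x₀)` and for an event `S = {rowStat ∈ A}`, the mass of
`S ∩ G ∩ {row 0 = y}` is the kernel value times the mass of `S ∩ G`. [folklore] -/
theorem tc_atom_identity (i : ℤ) (T : Set ℤ) (hF : TcFactorisation i T) (x₀ : Obs) (hb : tcBoth i (pinnedStat i x₀))
    {A : Set ((Obs × Set (Site 2 × Site 2)) × Obs)} (hA : MeasurableSet A) (y : Bool × Bool × Bool) :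
    νmix T ({x | rowStat i x ∈ A} ∩ tcEv i (rowStat i x₀) ∩ {x | rowBool i x = y}) =
      ENNReal.ofReal (tcK i T (rowStat i x₀) y) * νmix T ({x | rowStat i x ∈ A} ∩ tcEv i (rowStat i x₀)) := by
  haveI := isProbabilityMeasure_nuMix T
  set G := tcEv i (rowStat i x₀) with hG
  have key := hF (pinnedStat i x₀) (pastMid i 0 x₀) hb.1 hb.2 A hA y
  change νmix T ({x | rowStat i x ∈ A} ∩ G ∩ {x | rowBool i x = y}) * νmix T G =
    νmix T (G ∩ {x | rowBool i x = y}) * νmix T ({x | rowStat i x ∈ A} ∩ G) at key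
  rw [tcK_rowStat_eq i T x₀ hb y]
  by_cases h0 : νmix T G = 0
  · rw [← hG, if_pos h0]
    have h1 : νmix T ({x | rowStat i x ∈ A} ∩ G ∩ {x | rowBool i x = y}) = 0 :=
      measure_mono_null (fun x hx => hx.1.2) h0
    have h2 : νmix T ({x | rowStat i x ∈ A} ∩ G) = 0 := measure_mono_null (fun x hx => hx.2) h0
    rw [h1, h2, mul_zero]
  · rw [← hG, if_neg h0]
    have hGtop : νmix T G ≠ ⊤ := measure_ne_top _ _
    have hpos : 0 < (νmix T G).toReal := ENNReal.toReal_pos h0 hGtop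
    set X := νmix T ({x | rowStat i x ∈ A} ∩ G ∩ {x | rowBool i x = y}) with hX
    rw [ENNReal.ofReal_div_of_pos hpos, ENNReal.ofReal_toReal (measure_ne_top _ _), ENNReal.ofReal_toReal hGtop,
      ENNReal.div_eq_inv_mul, mul_assoc, ← key, mul_comm X (νmix T G), ← mul_assoc, ENNReal.inv_mul_cancel h0 hGtop, one_mul]

/-! ## §3 The law -/

/-- THE LAW ON `tcBoth`: fibrewise over the countable code. [folklore] -/
theorem tc_law_both (i : ℤ) (T : Set ℤ) (hF : TcFactorisation i T) {A : Set ((Obs × Set (Site 2 × Site 2)) × Obs)}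
    (hA : MeasurableSet A) (hsub : A ⊆ {t | tcBoth i t.1}) (y : Bool × Bool × Bool) :
    νmix T {x | rowStat i x ∈ A ∧ rowBool i x = y} =
      ∫⁻ x in rowStat i ⁻¹' A, ENNReal.ofReal (tcK i T (rowStat i x) y) ∂(νmix T) := by
  haveI := isProbabilityMeasure_nuMix T
  have hD := measurable_tcCode i
  have hS : MeasurableSet (rowStat i ⁻¹' A) := (measurable_rowStat i) hA
  have hY : MeasurableSet {x : Obs | rowBool i x = y} := (measurable_rowBool i) (measurableSet_singleton y)
  -- decompose both sides along the fibres of the code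
  have hfib : ∀ d, MeasurableSet (tcCode i ⁻¹' {d}) := fun d => hD (measurableSet_singleton d)
  have hdisj : Pairwise (Function.onFun Disjoint fun d : TcCodeSp => rowStat i ⁻¹' A ∩ tcCode i ⁻¹' {d}) :=
    fun d d' hne => disjoint_left.2 fun x h1 h2 => hne (h1.2.symm.trans h2.2)
  have hdisj' : Pairwise (Function.onFun Disjoint fun d : TcCodeSp => (rowStat i ⁻¹' A ∩ tcCode i ⁻¹' {d}) ∩ {x | rowBool i x = y}) :=
    fun d d' hne => disjoint_left.2 fun x h1 h2 => hne (h1.1.2.symm.trans h2.1.2)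
  have hU1 : {x : Obs | rowStat i x ∈ A ∧ rowBool i x = y} = ⋃ d, (rowStat i ⁻¹' A ∩ tcCode i ⁻¹' {d}) ∩ {x | rowBool i x = y} := by
    ext x; simp only [mem_setOf_eq, mem_iUnion, mem_inter_iff, mem_preimage, mem_singleton_iff]
    exact ⟨fun ⟨h1, h2⟩ => ⟨_, ⟨h1, rfl⟩, h2⟩, fun ⟨d, ⟨h1, _⟩, h2⟩ => ⟨h1, h2⟩⟩
  have hU2 : rowStat i ⁻¹' A = ⋃ d, rowStat i ⁻¹' A ∩ tcCode i ⁻¹' {d} := by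
    ext x; simp only [mem_iUnion, mem_inter_iff, mem_preimage, mem_singleton_iff]
    exact ⟨fun h1 => ⟨_, h1, rfl⟩, fun ⟨d, h1, _⟩ => h1⟩
  have hL : νmix T {x : Obs | rowStat i x ∈ A ∧ rowBool i x = y} =
      ∑' d, νmix T ((rowStat i ⁻¹' A ∩ tcCode i ⁻¹' {d}) ∩ {x | rowBool i x = y}) := by
    rw [hU1, measure_iUnion hdisj' fun d => ((hS.inter (hfib d)).inter hY)]
  have hR : ∫⁻ x in rowStat i ⁻¹' A, ENNReal.ofReal (tcK i T (rowStat i x) y) ∂(νmix T) =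
      ∑' d, ∫⁻ x in rowStat i ⁻¹' A ∩ tcCode i ⁻¹' {d}, ENNReal.ofReal (tcK i T (rowStat i x) y) ∂(νmix T) := by
    rw [← lintegral_iUnion (fun d => hS.inter (hfib d)) hdisj, ← hU2]
  rw [hL, hR]
  refine tsum_congr fun d => ?_
  by_cases hne : (rowStat i ⁻¹' A ∩ tcCode i ⁻¹' {d}).Nonempty
  · obtain ⟨x₀, hx₀A, hx₀d⟩ := hne
    have hb₀ : tcBoth i (pinnedStat i x₀) := hsub hx₀A
    have hGeq : tcEv i (rowStat i x₀) = tcCode i ⁻¹' {d} := by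
      rw [tcEv_eq_fibre i x₀ hb₀]; ext x; simp only [mem_setOf_eq, mem_preimage, mem_singleton_iff]; rw [show tcCode i x₀ = d from hx₀d]
    -- the kernel is constant on the fibre
    have hconst : ∀ x ∈ rowStat i ⁻¹' A ∩ tcCode i ⁻¹' {d}, ENNReal.ofReal (tcK i T (rowStat i x) y) = ENNReal.ofReal (tcK i T (rowStat i x₀) y) := by
      rintro x ⟨hxA, hxd⟩
      have hbx : tcBoth i (pinnedStat i x) := hsub hxA
      have hEx : tcEv i (rowStat i x) = tcEv i (rowStat i x₀) := by
        rw [tcEv_eq_fibre i x hbx, hGeq]; ext x'; simp only [mem_setOf_eq, mem_preimage, mem_singleton_iff]; rw [show tcCode i x = d from hxd]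
      rw [tcK_rowStat_eq i T x hbx, tcK_rowStat_eq i T x₀ hb₀, hEx]
    rw [setLIntegral_congr_fun (hS.inter (hfib d)) hconst, setLIntegral_const]
    have e1 : (rowStat i ⁻¹' A ∩ tcCode i ⁻¹' {d}) ∩ {x | rowBool i x = y} = {x | rowStat i x ∈ A} ∩ tcEv i (rowStat i x₀) ∩ {x | rowBool i x = y} := by
      rw [hGeq]; rfl
    have e2 : rowStat i ⁻¹' A ∩ tcCode i ⁻¹' {d} = {x | rowStat i x ∈ A} ∩ tcEv i (rowStat i x₀) := by rw [hGeq]; rfl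
    rw [e1, e2]
    exact tc_atom_identity i T hF x₀ hb₀ hA y
  · rw [not_nonempty_iff_eq_empty] at hne
    rw [hne, empty_inter, measure_empty, Measure.restrict_empty, lintegral_zero_measure]

/-- THE LAW OF THE TWO-SIDED KERNEL (registered sub-goal `tc_kernel_law_of`): given the factorisation identity, `tcK i T`
is a version of the conditional law of the middle row `0` of `νmix T` given the row statistic. [folklore] -/
theorem tc_kernel_law_of : ∀ (i : ℤ) (T : Set ℤ), (i ∈ T ↔ i + 1 ∉ T) → TcFactorisation i T →
    ∀ (A : Set ((Obs × Set (Site 2 × Site 2)) × Obs)), MeasurableSet A → ∀ y : Bool × Bool × Bool,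
      νmix T {x | rowStat i x ∈ A ∧ rowBool i x = y} =
        ∫⁻ x in rowStat i ⁻¹' A, ENNReal.ofReal (tcK i T (rowStat i x) y) ∂(νmix T) := by
  intro i T hT hF A hA y
  haveI := isProbabilityMeasure_nuMix T
  set A₁ : Set ((Obs × Set (Site 2 × Site 2)) × Obs) := A ∩ {t | tcBoth i t.1} with hA₁
  set A₀ : Set ((Obs × Set (Site 2 × Site 2)) × Obs) := A ∩ {t | ¬ tcBoth i t.1} with hA₀
  have hB : MeasurableSet {t : (Obs × Set (Site 2 × Site 2)) × Obs | tcBoth i t.1} := measurable_fst (measurableSet_tcBoth i)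
  have hA₁m : MeasurableSet A₁ := hA.inter hB
  have hA₀m : MeasurableSet A₀ := hA.inter hB.compl
  have hY : MeasurableSet {x : Obs | rowBool i x = y} := (measurable_rowBool i) (measurableSet_singleton y)
  -- split both sides
  have hsplitL : {x : Obs | rowStat i x ∈ A ∧ rowBool i x = y} =
      {x | rowStat i x ∈ A₀ ∧ rowBool i x = y} ∪ {x | rowStat i x ∈ A₁ ∧ rowBool i x = y} := by
    ext x; simp only [hA₀, hA₁, mem_setOf_eq, mem_union, mem_inter_iff]; tauto
  have hdisjL : Disjoint {x : Obs | rowStat i x ∈ A₀ ∧ rowBool i x = y} {x | rowStat i x ∈ A₁ ∧ rowBool i x = y} :=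
    disjoint_left.2 fun x h1 h2 => h1.1.2 h2.1.2
  have hsplitR : rowStat i ⁻¹' A = rowStat i ⁻¹' A₀ ∪ rowStat i ⁻¹' A₁ := by
    ext x; simp only [hA₀, hA₁, mem_preimage, mem_union, mem_inter_iff, mem_setOf_eq]; tauto
  have hdisjR : Disjoint (rowStat i ⁻¹' A₀) (rowStat i ⁻¹' A₁) := disjoint_left.2 fun x h1 h2 => h1.2 h2.2
  rw [hsplitL, measure_union hdisjL (((measurable_rowStat i) hA₁m).inter hY), hsplitR,
    lintegral_union ((measurable_rowStat i) hA₁m) hdisjR]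
  congr 1
  · -- off `tcBoth`: the one-sided kernel
    rw [cmk_kernel_law i T hT A₀ hA₀m y]
    refine setLIntegral_congr_fun ((measurable_rowStat i) hA₀m) fun x hx => ?_
    have : ¬ tcBoth i (rowStat i x).1 := hx.2
    simp only [tcK, this, if_false]
  · exact tc_law_both i T hF hA₁m (fun t ht => ht.2) y

/-- THE TWO-SIDED CUT-MARKOV VERSION, modulo the factorisation identity. [folklore] -/
theorem tc_cutMarkovKernel_of (i : ℤ) (S : Set ℤ) (hS : i ∈ S ↔ i + 1 ∉ S)
    (hF : TcFactorisation i (S ∆ {i, i + 1})) : CutMarkovKernel S i (tcK i (S ∆ {i, i + 1})) ∧ ReadsEnv i (tcK i (S ∆ {i, i + 1})) := by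
  have hT : i ∈ S ∆ {i, i + 1} ↔ i + 1 ∉ S ∆ {i, i + 1} := by
    simp only [mem_symmDiff, mem_insert_iff, mem_singleton_iff]
    constructor <;> intro h1 <;> [skip; skip] <;> (first | omega | tauto)
  have hk : CutMarkovKernel S i (tcK i (S ∆ {i, i + 1})) :=
    { measurable := tc_kernel_measurable i _
      nonneg := tc_kernel_nonneg i _
      sum_one := tc_kernel_sum_one i _
      reads := fun p z z' c hc hcut hz => tc_kernel_reads i _ p z z' c hc hcut hz
      law := fun A hA b => tc_kernel_law_of i _ hT hF A hA b }
  exact ⟨hk, tc_readsEnv i _⟩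

end Summit.CriticalPhenomena.CardyFormulaZ2.Theorems.IKLinearTransport.PinnedDiagramExchange
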